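import Literature.NumberTheory.EllipticCurves.TwoAdicImageNonSurjectiveFamiliesProofs
import Literature.NumberTheory.EllipticCurves.TwoAdicImageSurjectivityModTwoProofs
import Literature.NumberTheory.EllipticCurves.TwoAdicImageSurjectivityModFourProofs
import HarnessLib

/-!
# Route `ByReductionTypeAtTwo`, crux `RankOneAtTwoOffBigImageOddLocal` (stmt-BirchSwinnertonDyer-23716), line
# `refined_kolyvagin_tamagawa_shift_at_two`: the SIGN ATLAS of the S₃-locus (helpers, PROVED; Literature-only imports)

Lead prover `prover-cruxlead-stmt-BirchSwinnertonDyer-23716-g0` (2026-08-28).  §3⁗ of the registered skeleton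
`Cruxes/RankOneAtTwoOffBigImageOddLocal/Lines/refined_kolyvagin_tamagawa_shift_at_two.lean` (g6), landed as a `--supports` helper of the crux with the
cell predicates spelled out (`IsSquare (-W.Δ)` for γ₂a, `∃ t, j = −4t³(t+8)` for γ₂b, `IsSquare (2·W.Δ)` for γ₂c, `IsSquare (-2·W.Δ)` for γ₂d):
on the S₃-LOCUS {`ρ̄_{W,2}` onto} of a Weierstrass curve `W/ℚ`,

* `Δ_mul_j_sub_1728` — `Δ·(j − 1728) = c₆²`;
* `exists_two_torsion_of_j_eq_1728`, `j_ne_1728_of_hasSurjectiveModNGaloisRep_two` — `j = 1728` forces a rational point of order `2`, so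
  `ρ̄_{W,2}` onto ⟹ `j ≠ 1728`;
* `delta_neg_of_gamma2b` — `ρ̄_{W,2}` onto and `j = −4t³(t+8)` ⟹ `Δ < 0` (`j − 1728 = −4(t+6)²((t−2)²+8)`); `delta_neg_of_isSquare_neg_Δ`,
  `delta_neg_of_isSquare_neg_two_mul_Δ` — γ₂a, γ₂d have `Δ < 0`;
* `forall_hasSurjectiveModNGaloisRep_two_pow_of_pos` — THE δ⁺ COVER LEMMA: `ρ̄_{W,2}` onto, `Δ > 0`, `2Δ ∉ ℚ^{×2}` ⟹ the `2`-adic image is FULL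
  (`ρ_{W,2^n}` onto for every `n`), by the tree's typed Dokchitser–Dokchitser / Rouse–Zureick-Brown complement
  `not_forall_hasSurjectiveModNGaloisRep_two_pow_iff`;
* `sign_cells_cover` — the S₃-locus is covered by the three SIGN cells {`Δ < 0`}, δ⁺ = {`Δ > 0` ∧ full `2`-adic image}, γ₂c = {`2Δ ∈ ℚ^{×2}`};
* `gamma2abd_of_neg_of_not_forall_surjective` — on the S₃-locus, `Δ < 0` off the full image is γ₂a ∪ γ₂b ∪ γ₂d.

This is the kernel-checked cover under which the line's three-cell / four-cell atlases glue K-side Kolyvagin charts (filter `Φ_reg` on δ⁺, `⊤` on γ₂c)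
and E-side charts.  BSD is not proved by this; the crux is not proved by this (its seven registered stubs are untouched).

References: [SilvermanAEC2009] III.1, Prop. III.2.3; [DokchitserDokchitserMathZ2012] Theorem (1)–(3); [RouseZureickbrown2015] §3.
-/

set_option linter.dupNamespace false -- tree convention: `Summit.BirchSwinnertonDyer.BirchSwinnertonDyer.Theorems` (summit = sub-problem)
set_option autoImplicit false
noncomputable section

open scoped Classical

namespace Summit.BirchSwinnertonDyer.BirchSwinnertonDyer.Theorems.OffBigImageOddLocalAtTwo

open WeierstrassCurve Literature.NumberTheory.EllipticCurves

/-- `Δ · (j − 1728) = c₆²` (from `j·Δ = c₄³` and `1728Δ = c₄³ − c₆²`). [cite: SilvermanAEC2009, III.1] -/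
theorem Δ_mul_j_sub_1728 (W : WeierstrassCurve ℚ) [W.IsElliptic] : W.Δ * (W.j - 1728) = W.c₆ ^ 2 := by
  have hjΔ : W.j * W.Δ = W.c₄ ^ 3 := DokchitserDokchitser2012.j_mul_Δ W
  have hrel : 1728 * W.Δ = W.c₄ ^ 3 - W.c₆ ^ 2 := W.c_relation
  linear_combination hjΔ - hrel

/-- `j = 1728` ⟹ a rational point of exact order `2` (`κ = −2` in the `X₀(2)` parametrisation of the tree lemma `exists_two_torsion_of_j_mul_eq`;
the curves `y² = x³ + ax`). [cite: SilvermanAEC2009, Prop. III.2.3] -/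
theorem exists_two_torsion_of_j_eq_1728 (W : WeierstrassCurve ℚ) [W.IsElliptic] (hj : W.j = 1728) :
    ∃ P : W.toAffine.Point, P ≠ 0 ∧ 2 • P = 0 :=
  exists_two_torsion_of_j_mul_eq W two_ne_zero three_ne_zero (-2) (by norm_num) (by rw [hj]; norm_num)

/-- `ρ̄_{W,2}` onto ⟹ `j ≠ 1728`. [cite: DokchitserDokchitserMathZ2012, Theorem (1)] -/
theorem j_ne_1728_of_hasSurjectiveModNGaloisRep_two (W : WeierstrassCurve ℚ) [W.IsElliptic] (hρ : W.HasSurjectiveModNGaloisRep 2) :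
    W.j ≠ 1728 := by
  intro hj
  obtain ⟨P, hP0, h2P⟩ := exists_two_torsion_of_j_eq_1728 W hj
  exact hP0 (((hasSurjectiveModNGaloisRep_two_iff W).mp hρ).1 P h2P)

/-- On γ₂b, `j − 1728 = −4 (t + 6)² ((t − 2)² + 8)`. [folklore] -/
theorem j_sub_1728_of_gamma2b (W : WeierstrassCurve ℚ) [W.IsElliptic] {t : ℚ} (hj : W.j = -4 * t ^ 3 * (t + 8)) :
    W.j - 1728 = -4 * (t + 6) ^ 2 * ((t - 2) ^ 2 + 8) := by
  rw [hj]; ring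

/-- **γ₂b lies in `Δ < 0` on the S₃-locus**: `ρ̄_{W,2}` onto and `j = −4t³(t+8)` ⟹ `Δ < 0` (`j − 1728 = −4(t+6)²((t−2)²+8) ≤ 0` with equality iff
`j = 1728`, excluded by the rational `2`-torsion point it forces; `Δ(j − 1728) = c₆² ≥ 0`). [cite: DokchitserDokchitserMathZ2012, Theorem (2)] -/
theorem delta_neg_of_gamma2b (W : WeierstrassCurve ℚ) [W.IsElliptic] (hρ : W.HasSurjectiveModNGaloisRep 2)
    (h : ∃ t : ℚ, W.j = -4 * t ^ 3 * (t + 8)) : W.Δ < 0 := by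
  obtain ⟨t, ht⟩ := h
  have hj : W.j ≠ 1728 := j_ne_1728_of_hasSurjectiveModNGaloisRep_two W hρ
  have hle : W.j - 1728 ≤ 0 := by
    rw [j_sub_1728_of_gamma2b W ht]
    nlinarith [sq_nonneg (t + 6), sq_nonneg (t - 2), mul_nonneg (sq_nonneg (t + 6)) (sq_nonneg (t - 2))]
  have hlt : W.j - 1728 < 0 := lt_of_le_of_ne hle (sub_ne_zero.mpr hj)
  rcases lt_trichotomy W.Δ 0 with hΔ | hΔ | hΔ
  · exact hΔ
  · exact absurd hΔ W.isUnit_Δ.ne_zero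
  · exfalso
    have hneg : W.Δ * (W.j - 1728) < 0 := mul_neg_of_pos_of_neg hΔ hlt
    rw [Δ_mul_j_sub_1728 W] at hneg
    exact absurd hneg (not_lt.mpr (sq_nonneg _))

/-- γ₂a (`−Δ ∈ ℚ^{×2}`) lies in `Δ < 0`. [folklore] -/
theorem delta_neg_of_isSquare_neg_Δ (W : WeierstrassCurve ℚ) [W.IsElliptic] (h : IsSquare (-W.Δ)) : W.Δ < 0 := by
  obtain ⟨r, hr⟩ := h
  have hle : W.Δ ≤ 0 := by nlinarith [mul_self_nonneg r]
  exact lt_of_le_of_ne hle W.isUnit_Δ.ne_zero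

/-- γ₂d (`−2Δ ∈ ℚ^{×2}`) lies in `Δ < 0`. [folklore] -/
theorem delta_neg_of_isSquare_neg_two_mul_Δ (W : WeierstrassCurve ℚ) [W.IsElliptic] (h : IsSquare (-2 * W.Δ)) : W.Δ < 0 := by
  obtain ⟨r, hr⟩ := h
  have hle : W.Δ ≤ 0 := by nlinarith [mul_self_nonneg r]
  exact lt_of_le_of_ne hle W.isUnit_Δ.ne_zero

/-- γ₂c (`2Δ ∈ ℚ^{×2}`) lies in `Δ > 0`. [folklore] -/
theorem delta_pos_of_isSquare_two_mul_Δ (W : WeierstrassCurve ℚ) [W.IsElliptic] (h : IsSquare (2 * W.Δ)) : 0 < W.Δ := by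
  obtain ⟨r, hr⟩ := h
  have hle : 0 ≤ W.Δ := by nlinarith [mul_self_nonneg r]
  exact lt_of_le_of_ne hle (Ne.symm W.isUnit_Δ.ne_zero)

/-- **THE δ⁺ COVER LEMMA**: on the S₃-locus (`ρ̄_{W,2}` onto), `Δ > 0` and `2Δ ∉ ℚ^{×2}` ⟹ the `2`-adic image is FULL (`ρ_{W,2^n}` onto for every
`n`).  By the typed complement `not_forall_hasSurjectiveModNGaloisRep_two_pow_iff`: (β) a rational `2`-torsion point and (γ₁) `Δ ∈ ℚ^{×2}` contradict
`ρ̄₂` onto, (γ₂a), (γ₂b), (γ₂d) force `Δ < 0`, (γ₂c) is excluded by hypothesis. [cite: DokchitserDokchitserMathZ2012, Theorem (1)–(3)]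
[cite: RouseZureickbrown2015, §3] -/
theorem forall_hasSurjectiveModNGaloisRep_two_pow_of_pos (W : WeierstrassCurve ℚ) [W.IsElliptic] (hρ : W.HasSurjectiveModNGaloisRep 2)
    (hΔ : 0 < W.Δ) (hc : ¬ IsSquare (2 * W.Δ)) : ∀ n : ℕ, W.HasSurjectiveModNGaloisRep ((2 ^ n : ℕ) : ℤ) := by
  by_contra hns
  obtain ⟨hP, hsq⟩ := (hasSurjectiveModNGaloisRep_two_iff W).mp hρ
  rcases (not_forall_hasSurjectiveModNGaloisRep_two_pow_iff W).mp hns with ⟨P, hP0, h2P⟩ | h1 | h2a | h2b | h2c | h2d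
  · exact hP0 (hP P h2P)
  · exact hsq h1
  · exact lt_asymm (delta_neg_of_isSquare_neg_Δ W h2a) hΔ
  · exact lt_asymm (delta_neg_of_gamma2b W hρ h2b) hΔ
  · exact hc h2c
  · exact lt_asymm (delta_neg_of_isSquare_neg_two_mul_Δ W h2d) hΔ

/-- **The S₃-locus is covered by the three SIGN cells** `Δ < 0`, δ⁺ (`Δ > 0` with full `2`-adic image), γ₂c (`2Δ ∈ ℚ^{×2}`).
[cite: DokchitserDokchitserMathZ2012, Theorem (1)–(3)] -/
theorem sign_cells_cover (W : WeierstrassCurve ℚ) [W.IsElliptic] (hρ : W.HasSurjectiveModNGaloisRep 2) :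
    W.Δ < 0 ∨ (0 < W.Δ ∧ ∀ n : ℕ, W.HasSurjectiveModNGaloisRep ((2 ^ n : ℕ) : ℤ)) ∨ IsSquare (2 * W.Δ) := by
  rcases lt_or_lt_iff_ne.mpr W.isUnit_Δ.ne_zero with h | h
  · exact Or.inl h
  · by_cases hc : IsSquare (2 * W.Δ)
    · exact Or.inr (Or.inr hc)
    · exact Or.inr (Or.inl ⟨h, forall_hasSurjectiveModNGaloisRep_two_pow_of_pos W hρ h hc⟩)

/-- **On the S₃-locus the `Δ < 0` cell off the full `2`-adic image is γ₂a ∪ γ₂b ∪ γ₂d** (γ₂c has `Δ > 0`; β, γ₁ are off the locus).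
[cite: DokchitserDokchitserMathZ2012, Theorem (1)–(3)] [cite: RouseZureickbrown2015, §3] -/
theorem gamma2abd_of_neg_of_not_forall_surjective (W : WeierstrassCurve ℚ) [W.IsElliptic] (hρ : W.HasSurjectiveModNGaloisRep 2)
    (hΔ : W.Δ < 0) (hns : ¬ ∀ n : ℕ, W.HasSurjectiveModNGaloisRep ((2 ^ n : ℕ) : ℤ)) :
    IsSquare (-W.Δ) ∨ (∃ t : ℚ, W.j = -4 * t ^ 3 * (t + 8)) ∨ IsSquare (-2 * W.Δ) := by
  obtain ⟨hP, hsq⟩ := (hasSurjectiveModNGaloisRep_two_iff W).mp hρ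
  rcases (not_forall_hasSurjectiveModNGaloisRep_two_pow_iff W).mp hns with ⟨P, hP0, h2P⟩ | h1 | h2a | h2b | h2c | h2d
  · exact absurd (hP P h2P) hP0
  · exact absurd h1 hsq
  · exact Or.inl h2a
  · exact Or.inr (Or.inl h2b)
  · exact absurd hΔ (lt_asymm (delta_pos_of_isSquare_two_mul_Δ W h2c))
  · exact Or.inr (Or.inr h2d)

end Summit.BirchSwinnertonDyer.BirchSwinnertonDyer.Theorems.OffBigImageOddLocalAtTwo

end
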